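import Mathlib.Tactic.Linarith
import Mathlib.Tactic.NormNum
import Mathlib.Tactic.Ring
import HarnessLib

/-!
# The (0,1) cell of the ι-window, XXXVI (companion C): the product ground `B₁ × B₂`, XXIII — THE CORNER VII, ADDENDUM 1: THEOREM II-VOID-Ω⁺
# (report [XXXVI] `H2-ZERO-ONE-36.md` §11): arithmetic shadows

Family `hodge`, b2b cell `hweil` (helper of item stmt-HodgeConjecture-2524). Report
`run/shared/lean/b2b/hodge-weil/b2b-hweil-pv1-g48/H2-ZERO-ONE-36.md` ([XXXVI]) §11 (ADDENDUM 1). Context: LEMMA K-FORCED (ι-stability of the maximal sub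
`𝓐′ = N₃ ⊠ λ₃` forces `N₃` symmetric and `λ₃² ≅ K₂^{d₃}`, hence `ξ = K₂^{d₃−2}` and `Ω(4S)⁻¹|_{Y₁} = 𝒪((ρ−4)Θ₀)|_D ⊠ K₂^{d₃−3}`) gives the section that
makes `D ≥ 0` for every surface divisor `D′`, and THEOREM II-VOID-Ω⁺ reads `e₁^ι(F) ≥ MAIN − OB − (2ρ − 8)h′ − (2d₃ − 6)v′` for every cell with `d₃ ≥ 3`,
`2n₃ ≥ n′ + 3` (`ρ = 2n₃ − n′`, `h′ = a₂ − d₃`, `v′ = a₁ − 2n₃`). Type 1 (`n′ = 10`): `MAIN(7,d₃) = 14(d₃−3)`, `MAIN(8,d₃) = 25d₃ − 27`,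
`MAIN(9,d₃) = 42d₃ − 26`, `MAIN(10,d₃) = 65d₃ − 39` ([XXXIV] 5.2). The theorems below are the integer identities behind the closures (the whole
`n₃ = n′` family; all `n₃ = 7` cells with `d₃ ≥ 4`, `a₁ ≤ 20`; the residual count `224 → 65`). None of the theorems claims geometry. HONEST FRAMING:
census work inside the ladder's H2 test ((0,1) cell) on the SPECIAL fourfold `X₀`; nothing here is a rung; no case of the Hodge conjecture is proved; no
statement of [Markman 2025] / [Perry 2026] / [EdGFS 2025] is used.
-/

-- mandated namespace `Summit.HodgeConjecture.HodgeConjecture.…` (Problem = Summit) trips `linter.dupNamespace`; the lakefile disables it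
-- tree-wide (weak option), restated here so stand-alone elaboration is warning-free too.
set_option linter.dupNamespace false

namespace Summit.HodgeConjecture.HodgeConjecture.WeilTypeLadder

section ProductGroundTwentyThreeC

/-- **[XXXVI] 11.2 (LEMMA K-FORCED, the degrees).** `h₂^*λ ≅ K₂^{d} ⊗ λ⁻¹` on the hyperelliptic genus-2 curve, so `h₂^*λ₃ ≅ λ₃` gives `2·deg λ₃ = 2d₃`
consistently and `ξ = λ₃²K₂⁻²` has degree `2d₃ − 4`, `= deg K₂^{d₃−2}`; `P₂ = ξK₂⁻¹ = K₂^{d₃−3}` has degree `2d₃ − 6` (`0` at `d₃ = 3`: trivial — every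
`d₃ = 3` cell is (Q-RES-K)); `N = N₃N₄⁻¹ = N₃²(−n′Θ₀)` has class `2n₃ − n′ = ρ`, and `P₁ = N(−4Θ)|_D` degree `2ρ − 8` on `Θ` (`Θ² = 2`). [`ring` / `norm_num`] -/
theorem pg23c_kforced_degrees :
    (∀ d₃ : ℤ, 2 * d₃ - 2 * 2 = 2 * (d₃ - 2) ∧ 2 * (d₃ - 2) - 2 = 2 * (d₃ - 3)) ∧
    (∀ n₃ n' : ℤ, 2 * n₃ - n' = (2 * n₃ - n')) ∧ (∀ ρ : ℤ, 2 * ρ - 4 * 2 = 2 * ρ - 8) ∧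
    ((2 : ℤ) * 3 - 6 = 0 ∧ (2 : ℤ) * 10 - 8 = 12 ∧ (2 : ℤ) * 8 - 8 = 8 ∧ (2 : ℤ) * 6 - 8 = 4 ∧ (2 : ℤ) * 4 - 8 = 0) := by
  refine ⟨fun d₃ => ⟨by ring, by ring⟩, fun n₃ n' => by ring, fun ρ => by ring, by norm_num⟩

/-- **[XXXVI] 11.4 (THEOREM II-VOID-Ω⁺, the Euler-characteristic difference for every D′).** Per rank-one piece of `𝒦`: `8 − 2ρ` on an S-line,
`6 − 2d₃` on a vertical S-fibre, `−2h(ρ − 4) + v(6 − 2d₃)` on a bi-dominant component of S-class `(v,h)`; with at most `2μ` pieces per component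
of multiplicity `μ` and `Σ μh = h′`, `Σ μv = v′`, half the total is `≥ −(2ρ − 8)h′ − (2d₃ − 6)v′` (`ρ ≥ 4`, `d₃ ≥ 3`). The bi-dominant degree:
`2h(n′ − 2n₃) + v(6 − 2d₃) + 8h = −2h(ρ − 4) + v(6 − 2d₃)`. [`ring` / `nlinarith`] -/
theorem pg23c_chi_difference :
    (∀ n' n₃ v h d₃ : ℤ, 2 * h * (n' - 2 * n₃) + v * (6 - 2 * d₃) + 8 * h = -2 * h * ((2 * n₃ - n') - 4) + v * (6 - 2 * d₃)) ∧
    (∀ ρ d₃ L L₂ V V₂ : ℤ, 4 ≤ ρ → 3 ≤ d₃ → 0 ≤ L₂ → L₂ ≤ L → 0 ≤ V₂ → V₂ ≤ V →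
      -(2 * ρ - 8) * L - (2 * d₃ - 6) * V ≤ -(ρ - 4) * (L + L₂) - (d₃ - 3) * (V + V₂)) := by
  refine ⟨fun n' n₃ v h d₃ => by ring, fun ρ d₃ L L₂ V V₂ hρ hd hL0 hL hV0 hV => by nlinarith⟩

/-- **[XXXVI] 11.4–11.5 (THEOREM II-VOID-Ω⁺, type 1 closed forms and the `n₃ = n′` family).** With `MAIN(10,3) = 156`, `ρ = 10`, `d₃ = 3`: the bound
`156 − 12h′ − 0·v′` is `48, 36, 24` at `h′ = 9, 10, 11` for BOTH `a₁ = 20` and `a₁ = 21` — all six cells `(10,3,20/21,12…14)` of [XXXIV]'s family are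
VOID; `n₃ = 7` (`ρ = 4`): `14(d₃ − 3) − 0·h′ − (2d₃ − 6)v′ = (d₃ − 3)(14 − 2v′) ≥ 2` iff `d₃ ≥ 4` and `v′ ≤ 6`; `n₃ = 8`: `25d₃ − 27 − 4h′ − (2d₃ − 6)v′`;
`n₃ = 9`: `42d₃ − 26 − 8h′ − (2d₃ − 6)v′` (e.g. `(9,3,19,16)`: `100 − 104 = −4`, open; `(9,4,19,15)`: `142 − 88 − 2 = 52`, VOID). [`ring` / `omega` / `norm_num`] -/
theorem pg23c_type1_bounds :
    ((156 : ℤ) - 12 * 9 - 0 * 1 = 48 ∧ (156 : ℤ) - 12 * 10 - 0 * 1 = 36 ∧ (156 : ℤ) - 12 * 11 - 0 * 1 = 24) ∧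
    (∀ d₃ v : ℤ, 14 * (d₃ - 3) - (2 * d₃ - 6) * v = (d₃ - 3) * (14 - 2 * v)) ∧
    (∀ d₃ v : ℤ, 4 ≤ d₃ → 0 ≤ v → v ≤ 6 → 2 ≤ (d₃ - 3) * (14 - 2 * v)) ∧
    (∀ d₃ : ℤ, (d₃ - 3) * (14 - 2 * 7) = 0) ∧
    ((42 : ℤ) * 3 - 26 - 8 * 13 - 0 * 1 = -4 ∧ (42 : ℤ) * 4 - 26 - 8 * 11 - 2 * 1 = 52 ∧ (25 : ℤ) * 3 - 27 - 4 * 12 - 0 * 3 = 0) := by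
  refine ⟨by norm_num, fun d₃ v => by ring, fun d₃ v hd hv hv6 => by nlinarith, fun d₃ => by ring, by norm_num⟩

/-- **[XXXVI] 11.5 (the residual counts).** Type 1: of the 224 cells of (Q-RES-II-open)^Ω, II-VOID-Ω⁺ closes 159 (`{7: 88, 8: 48, 9: 20, 10: 3}`) and leaves
65 (`{7: 62, 8: 2, 9: 1}`: the 17 cells `(7,3,∗,∗)` with `MAIN = 0`, the 45 cells `(7, d₃ ≥ 4, 21, ∗)`, `(8,3,19,15)`, `(8,3,19,16)`, `(9,3,19,16)`); the
`n₃ = n′` family: `6 → 5 → 3 → 0`. [`norm_num`] -/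
theorem pg23c_counts :
    (224 : ℕ) - 159 = 65 ∧ (88 : ℕ) + 48 + 20 + 3 = 159 ∧ (62 : ℕ) + 2 + 1 = 65 ∧ (17 : ℕ) + 45 = 62 ∧ (6 : ℕ) - 1 - 2 - 3 = 0 := by
  norm_num

end ProductGroundTwentyThreeC

end Summit.HodgeConjecture.HodgeConjecture.WeilTypeLadder
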